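import Summits.SmoothPoincare4.SmoothPoincare4.Theorems.ConvexBisectionAcyclicBisectionExistsChartTransition
import Summits.SmoothPoincare4.SmoothPoincare4.Theorems.ConvexBisectionAcyclicBisectionExistsCrossingNumberRescale
import Mathlib.MeasureTheory.Function.Jacobian
import Mathlib.MeasureTheory.Measure.Lebesgue.Basic
import Mathlib.Analysis.Calculus.Deriv.Inverse
import Mathlib.Topology.DiscreteSubset
import HarnessLib

/-!
# A small regular level of the transverse coordinate along a smooth page curve (Sard, `d = 1`)
(wave 5, brick X7-2 = step (ii) REGULAR LEVEL of the symmetry statement (R1)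
`crossingNumber_symm` for the missing lemma `crossingNumber_eq_stdSymp` of node N1a of stub
`stub_modelsOnFibred_of_reach` = NF4, line `modp-braid-orbits`, crux
`ConvexBisection.AcyclicBisectionExists`, item stmt-SmoothPoincare4-10508; registered sub-goal
`helper_exists_regular_level`)

Z6-REPORT §3 (R1)(ii): for a smooth `1`-periodic page map `φ` and a positively oriented annulus
chart `ψ` of the same page, the transverse coordinate of the core `f u = height ψ (φ (u, 0))`
is `C^∞` on the open set where `φ (u, 0)` lies in the open annulus of `ψ`
(`contDiffAt_height_comp_chart`, Y4-6).  **`exists_regular_level`**: for every `ε > 0` there is a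
level `k ∈ (−ε, ε)` such that the solutions `u ∈ [0, 1]` of `f u = k` (inside the annulus) form a
finite set `S ⊂ (0, 1)` at each point of which `f` is `C¹` with `f' ≠ 0`.

Proof: the critical values `f {f' = 0}` are Lebesgue-null (Sard in dimension one,
`volume_image_eq_zero_of_deriv_eq_zero`, from Mathlib's
`MeasureTheory.addHaar_image_eq_zero_of_det_fderivWithin_eq_zero`), so some `k ∈ (−ε, ε)`,
`|k| < 1/4`, avoids them and the value `f 0 = f 1`; the solution set is then compact (the level
curve `ψ(ℝ × {k})` is compact) and discrete (`HasDerivAt.eventually_ne`), hence finite.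
Everything is proved; no definitions, no named facts, no `sorry`.  References: J. M. Lee,
*Introduction to Smooth Manifolds* (2013), Thm. 6.10 (Sard) [LeeSmoothManifolds2013].
-/

noncomputable section

set_option linter.dupNamespace false

open scoped Manifold ContDiff Topology
open Set Function Filter MeasureTheory
open Literature.Topology.FourManifolds Literature.Topology.FourManifolds.LefschetzBase

namespace Summit.SmoothPoincare4.SmoothPoincare4.Theorems.AcyclicBisectionExists.ModpBraidOrbits

variable {g : ℕ} {c : ℂ} {φ ψ : ℝ × ℝ → Base g}

/-! ## §1 Sard's lemma in dimension one and regular values in an interval -/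

/-- **Sard's lemma in dimension one**: the image of a set at every point of which `F : ℝ → ℝ` is
differentiable with derivative `0` is Lebesgue-null. [cite: LeeSmoothManifolds2013, Thm. 6.10] -/
theorem volume_image_eq_zero_of_deriv_eq_zero {F : ℝ → ℝ} {Z : Set ℝ}
    (hZ : ∀ t ∈ Z, DifferentiableAt ℝ F t ∧ deriv F t = 0) : volume (F '' Z) = 0 := by
  have hdet : (ContinuousLinearMap.smulRight (1 : ℝ →L[ℝ] ℝ) (0 : ℝ)).det = 0 := by
    have h0 : ContinuousLinearMap.smulRight (1 : ℝ →L[ℝ] ℝ) (0 : ℝ) = 0 := by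
      ext
      simp
    rw [h0]
    simp [ContinuousLinearMap.det]
  refine addHaar_image_eq_zero_of_det_fderivWithin_eq_zero volume
    (f' := fun _ => ContinuousLinearMap.smulRight (1 : ℝ →L[ℝ] ℝ) (0 : ℝ)) (fun t ht => ?_)
    (fun _ _ => hdet)
  have h := (hZ t ht).1.hasDerivAt
  rw [(hZ t ht).2] at h
  exact (hasDerivAt_iff_hasFDerivAt.1 h).hasFDerivWithinAt

/-- **A symmetric interval is not Lebesgue-null**: it contains a point off any null set.
[folklore] -/
theorem exists_mem_Ioo_not_mem_of_volume_zero {B : Set ℝ} (hB : volume B = 0) {ε : ℝ}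
    (hε : 0 < ε) : ∃ k ∈ Ioo (-ε) ε, k ∉ B := by
  by_contra h
  push Not at h
  have h0 : volume (Ioo (-ε) ε) = 0 := measure_mono_null (fun k hk => h k hk) hB
  rw [Real.volume_Ioo, ENNReal.ofReal_eq_zero] at h0
  linarith

/-! ## §2 The regular level -/

/-- **A small regular level with finitely many transversal solutions** ((R1)(ii) of Z6 §3).
For a smooth `1`-periodic page map `φ` and a positively oriented annulus chart `ψ` of
`page g c` and every `ε > 0` there are a level `k ∈ (−ε, ε)` and a finite set `S ⊂ (0, 1)` such
that a parameter `u ∈ [0, 1]` has `φ (u, 0)` in the open annulus of `ψ` at height `k` iff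
`u ∈ S`, and at each `u ∈ S` the height `u ↦ height ψ (φ (u, 0))` is `C¹` with non-zero
derivative. [cite: LeeSmoothManifolds2013, Thm. 6.10] -/
theorem exists_regular_level (hc : ‖c‖ = 1) (hφs : ContMDiff 𝓘(ℝ, ℝ × ℝ) (𝓡∂ 4) ∞ φ)
    (hφ1 : ∀ u r, φ (u + 1, r) = φ (u, r)) (hφp : ∀ p, φ p ∈ page g c)
    (hψs : ContMDiff 𝓘(ℝ, ℝ × ℝ) (𝓡∂ 4) ∞ ψ) (hψ1 : ∀ u r, ψ (u + 1, r) = ψ (u, r))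
    (hψp : ∀ p, ψ p ∈ page g c) (hψi : InjOn ψ (Ico (0 : ℝ) 1 ×ˢ Ioo (-1 : ℝ) 1))
    (hψo : ∀ u r, r ∈ Ioo (-1 : ℝ) 1 →
      0 < inner ℝ (deriv (fun r' => (ψ (u, r')).1) r) (cplxJ (deriv (fun u' => (ψ (u', r)).1) u)))
    {ε : ℝ} (hε : 0 < ε) :
    ∃ k ∈ Ioo (-ε) ε, ∃ S : Finset ℝ, (∀ u ∈ S, u ∈ Ioo (0 : ℝ) 1) ∧
      (∀ u ∈ Icc (0 : ℝ) 1,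
        (φ (u, 0) ∈ ψ '' (univ ×ˢ Ioo (-1 : ℝ) 1) ∧ height ψ (φ (u, 0)) = k) ↔ u ∈ S) ∧
      ∀ u ∈ S, ContDiffAt ℝ 1 (fun u => height ψ (φ (u, 0))) u ∧
        deriv (fun u => height ψ (φ (u, 0))) u ≠ 0 := by
  set f : ℝ → ℝ := fun u => height ψ (φ (u, 0)) with hf
  -- `f` is `C¹` wherever `φ (u, 0)` lies in the open annulus of `ψ`
  have hsm : ∀ u, φ (u, 0) ∈ ψ '' (univ ×ˢ Ioo (-1 : ℝ) 1) → ContDiffAt ℝ 1 f u := by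
    intro u hu
    obtain ⟨h2, hq⟩ := prelift_spec hu
    obtain ⟨T, -, -, -, hT⟩ := contDiffAt_height_comp_chart hc hφs hφp hψs hψ1 hψp hψi hψo
      (p₀ := (u, 0)) h2 hq.symm
    have hline : ContDiff ℝ ∞ (fun u : ℝ => ((u, (0 : ℝ)) : ℝ × ℝ)) := by fun_prop
    have h := hT.comp u hline.contDiffAt
    exact h.of_le (by norm_cast)
  have hdiff : ∀ u, φ (u, 0) ∈ ψ '' (univ ×ˢ Ioo (-1 : ℝ) 1) → DifferentiableAt ℝ f u :=
    fun u hu => (hsm u hu).differentiableAt (by simp)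
  -- Sard: the critical values and the value at `0` form a null set; pick `k` off it
  set Crit : Set ℝ := {u | φ (u, 0) ∈ ψ '' (univ ×ˢ Ioo (-1 : ℝ) 1) ∧ deriv f u = 0} with hCrit
  have hCv : volume (f '' Crit) = 0 :=
    volume_image_eq_zero_of_deriv_eq_zero fun t ht => ⟨hdiff t ht.1, ht.2⟩
  have hB : volume (f '' Crit ∪ {f 0}) = 0 := measure_union_null hCv Real.volume_singleton
  obtain ⟨k, hk, hkB⟩ := exists_mem_Ioo_not_mem_of_volume_zero hB
    (lt_min hε (by norm_num : (0 : ℝ) < 1 / 4))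
  have hkε : k ∈ Ioo (-ε) ε :=
    ⟨by linarith [hk.1, min_le_left ε (1 / 4)], by linarith [hk.2, min_le_left ε (1 / 4)]⟩
  have hk1 : k ∈ Ioo (-1 : ℝ) 1 :=
    ⟨by linarith [hk.1, min_le_right ε (1 / 4)], by linarith [hk.2, min_le_right ε (1 / 4)]⟩
  have hk0 : f 0 ≠ k := fun h => hkB (Or.inr h.symm)
  have hreg : ∀ u, φ (u, 0) ∈ ψ '' (univ ×ˢ Ioo (-1 : ℝ) 1) → f u = k → deriv f u ≠ 0 :=
    fun u hA hfk hd => hkB (Or.inl ⟨u, ⟨hA, hd⟩, hfk⟩)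
  -- the solution set: compact and discrete, hence finite
  set Z : Set ℝ := {u | u ∈ Icc (0 : ℝ) 1 ∧ φ (u, 0) ∈ ψ '' (univ ×ˢ Ioo (-1 : ℝ) 1) ∧ f u = k}
    with hZ
  have hZeq : Z = Icc (0 : ℝ) 1 ∩ (fun u : ℝ => φ (u, 0)) ⁻¹' (ψ '' (univ ×ˢ Icc k k)) := by
    ext u
    constructor
    · rintro ⟨hu, hA, hfk⟩
      obtain ⟨-, hq⟩ := prelift_spec hA
      refine ⟨hu, prelift ψ (φ (u, 0)), ⟨trivial, ?_⟩, hq⟩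
      have e : (prelift ψ (φ (u, 0))).2 = k := hfk
      rw [e]
      exact ⟨le_rfl, le_rfl⟩
    · rintro ⟨hu, p, ⟨-, hp⟩, hpq⟩
      have hpq' : ψ p = φ (u, 0) := hpq
      have hp2 : p.2 = k := le_antisymm hp.2 hp.1
      have hpI : p.2 ∈ Ioo (-1 : ℝ) 1 := hp2 ▸ hk1
      refine ⟨hu, ⟨p, ⟨trivial, hpI⟩, hpq'⟩, ?_⟩
      show height ψ (φ (u, 0)) = k
      rw [← hpq', ← hp2]
      exact height_of_lift hψ1 hψi (u₀ := p.1) (r₀ := p.2) hpI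
  have hcore : Continuous fun u : ℝ => φ (u, 0) :=
    hφs.continuous.comp (continuous_id.prodMk continuous_const)
  have hZc : IsCompact Z := by
    rw [hZeq]
    exact isCompact_Icc.inter_right
      (((isCompact_image_Icc hψs.continuous hψ1 k k).isClosed).preimage hcore)
  have hZd : IsDiscrete Z := by
    rw [isDiscrete_iff_nhdsNE]
    rintro u ⟨-, hA, hfk⟩
    rw [inf_principal_eq_bot]
    have hd : HasDerivAt f (deriv f u) u := (hdiff u hA).hasDerivAt
    filter_upwards [hd.eventually_ne (hreg u hA hfk) (c := k)] with z hz
    exact fun h => hz h.2.2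
  have hZf : Z.Finite := hZc.finite hZd
  -- the finite set of solutions
  refine ⟨k, hkε, hZf.toFinset, fun u hu => ?_, fun u hu => ?_, fun u hu => ?_⟩
  · obtain ⟨huI, hA, hfk⟩ := hZf.mem_toFinset.1 hu
    have h0 : u ≠ 0 := by
      rintro rfl
      exact hk0 hfk
    have h1 : u ≠ 1 := by
      rintro rfl
      apply hk0
      have e : f 1 = f 0 := by
        show height ψ (φ (1, 0)) = height ψ (φ (0, 0))
        rw [show ((1 : ℝ), (0 : ℝ)) = ((0 : ℝ) + 1, (0 : ℝ)) by norm_num, hφ1]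
      rw [← e, hfk]
    exact ⟨lt_of_le_of_ne huI.1 (Ne.symm h0), lt_of_le_of_ne huI.2 h1⟩
  · rw [hZf.mem_toFinset]
    exact ⟨fun h => ⟨hu, h.1, h.2⟩, fun h => ⟨h.2.1, h.2.2⟩⟩
  · obtain ⟨-, hA, hfk⟩ := hZf.mem_toFinset.1 hu
    exact ⟨hsm u hA, hreg u hA hfk⟩

/-! ## §3 The registered form -/

/-- **Sub-goal `helper_exists_regular_level`** (X7-2 = (R1)(ii) REGULAR LEVEL, a step of the
symmetry statement for node N1a of NF4): a small regular level, with finitely many transversal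
solutions in `(0, 1)`, of the transverse coordinate of a smooth periodic page curve in a
positively oriented annulus chart of the same page, in registered form.
[cite: LeeSmoothManifolds2013, Thm. 6.10] -/
theorem helper_exists_regular_level : ∀ (g : ℕ) (c : ℂ) (_hc : ‖c‖ = 1) (φ ψ : ℝ × ℝ → Literature.Topology.FourManifolds.LefschetzBase.Base g), ContMDiff 𝓘(ℝ, ℝ × ℝ) (𝓡∂ 4) ∞ φ → (∀ u r, φ (u + 1, r) = φ (u, r)) → (∀ p, φ p ∈ Literature.Topology.FourManifolds.LefschetzBase.page g c) → ContMDiff 𝓘(ℝ, ℝ × ℝ) (𝓡∂ 4) ∞ ψ → (∀ u r, ψ (u + 1, r) = ψ (u, r)) → (∀ p, ψ p ∈ Literature.Topology.FourManifolds.LefschetzBase.page g c) → Set.InjOn ψ (Set.Ico (0 : ℝ) 1 ×ˢ Set.Ioo (-1 : ℝ) 1) → (∀ u r, r ∈ Set.Ioo (-1 : ℝ) 1 → 0 < inner ℝ (deriv (fun r' => (ψ (u, r')).1) r) (Literature.Topology.FourManifolds.LefschetzBase.cplxJ (deriv (fun u' => (ψ (u', r)).1) u))) → ∀ (ε : ℝ),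 0 < ε → ∃ k ∈ Set.Ioo (-ε) ε, ∃ S : Finset ℝ, (∀ u ∈ S, u ∈ Set.Ioo (0 : ℝ) 1) ∧ (∀ u ∈ Set.Icc (0 : ℝ) 1, (φ (u, 0) ∈ ψ '' (Set.univ ×ˢ Set.Ioo (-1 : ℝ) 1) ∧ Summit.SmoothPoincare4.SmoothPoincare4.Theorems.AcyclicBisectionExists.ModpBraidOrbits.height ψ (φ (u, 0)) = k) ↔ u ∈ S) ∧ ∀ u ∈ S, ContDiffAt ℝ 1 (fun u => Summit.SmoothPoincare4.SmoothPoincare4.Theorems.AcyclicBisectionExists.ModpBraidOrbits.height ψ (φ (u, 0))) u ∧ deriv (fun u => Summit.SmoothPoincare4.SmoothPoincare4.Theorems.AcyclicBisectionExists.ModpBraidOrbits.height ψ (φ (u, 0))) u ≠ 0 :=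
  fun _ _ hc _ _ hφs hφ1 hφp hψs hψ1 hψp hψi hψo _ hε =>
    exists_regular_level hc hφs hφ1 hφp hψs hψ1 hψp hψi hψo hε

end Summit.SmoothPoincare4.SmoothPoincare4.Theorems.AcyclicBisectionExists.ModpBraidOrbits

end
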